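import Summits.CriticalPhenomena.PercolationContinuityZ3.Theorems.SahiAECornerEnvelopePrelim

/-!
# The lower-corner essential envelope of a LOCALLY bounded a.e.-monotone a.e.-MTP₂ density: a monotone version

Support file of the Sahi cell (`prim-sahi`, typer seat, generation 22; `--supports stmt-CriticalPhenomena-4575`).
Theorems only (no definitions, no named facts, no sorries).

`SahiAECornerEnvelope(Pos).lean` (typer g20/g21) prove: a measurable `g : ℝ^ι → [c₀, M]`, MTP₂ on Lebesgue-almost
every pair and non-decreasing on almost every comparable pair, has the Borel version
`F(p) = inf_n ess sup_{∏ᵢ (pᵢ − 1/(n+1), pᵢ]} g`, MTP₂ at EVERY pair, `c₀ ≤ F ≤ M`.  This file re-runs the construction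
with two changes needed by the two-dimensional structure theorem (`SahiAEPlane*.lean`, unbounded densities):

* the global bound `g ≤ M` is replaced by a LOCAL one — for every `q`, `g ≤ M_q < ∞` almost everywhere on the lower
  set `{z ≤ q}` (this is what a.e.-monotonicity gives below a generic point); then `F(p) ≤ M_p < ∞` everywhere;
* the version is in addition **MONOTONE AT EVERY comparable pair**: for `p ≤ p'` the corner essential suprema satisfy
  `ess sup_{C_r(p)} g ≤ ess sup_{C_r(p')} g` — a positive-measure subset of `C_r(p)` on which `g > a` lies strictly
  below a small corner at `p'` after discarding the faces (null hyperplanes), so the a.e. monotonicity on the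
  positive-measure product of the two sets pushes the level `a` into `C_r(p')`.

Result: `exists_measurable_monotone_mtp2_version_of_ae_local`.  No sorries, no new axioms.
-/

noncomputable section

namespace Summit.CriticalPhenomena.PercolationContinuityZ3.Theorems.SahiAEFourFunctions

open MeasureTheory Set Filter Topology Metric
open Summit.CriticalPhenomena.PercolationContinuityZ3.Theorems.SahiCMTP2
open scoped ENNReal NNReal

variable {ι : Type*} [Fintype ι]

/-! ### Monotonicity of the corner essential supremum -/

/-- **Corner essential suprema of an a.e.-monotone function are monotone in the corner.**  If `g` is non-decreasing on
Lebesgue-almost every comparable pair, then for `p ≤ p'` and `ε > 0`,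
`ess sup_{∏ (pᵢ − ε, pᵢ]} g ≤ ess sup_{∏ (p'ᵢ − ε, p'ᵢ]} g`. [this work] -/
theorem essSup_lowerCorner_mono {g : (ι → ℝ) → ℝ≥0∞} (hg : Measurable g)
    (hmono : ∀ᵐ p ∂(volume : Measure (ι → ℝ)).prod volume, p.1 ≤ p.2 → g p.1 ≤ g p.2) {ε : ℝ} (hε : 0 < ε)
    {p p' : ι → ℝ} (hpp' : p ≤ p') :
    essSup g (volume.restrict (Set.pi univ fun i => Ioc (p i - ε) (p i))) ≤
      essSup g (volume.restrict (Set.pi univ fun i => Ioc (p' i - ε) (p' i))) := by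
  set C := Set.pi univ fun i => Ioc (p i - ε) (p i) with hC
  set C' := Set.pi univ fun i => Ioc (p' i - ε) (p' i) with hC'
  set e' := essSup g (volume.restrict C') with he'
  by_contra hlt
  push Not at hlt
  obtain ⟨a, ha1, ha2⟩ := exists_between hlt
  -- the positive-measure superlevel set in `C`
  set A := {x | a < g x} ∩ C with hA
  have mA : MeasurableSet A := (measurableSet_lt measurable_const hg).inter (measurableSet_lowerCorner p _)
  have hA0 : volume A ≠ 0 := by
    rw [hA, ← Measure.restrict_apply (measurableSet_lt measurable_const hg)]
    exact measure_ne_zero_of_lt_essSup' ha2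
  -- shrink `A` away from the top faces of `C'`
  set δ : ℕ → ℝ := fun m => ε / ((m : ℝ) + 2) with hδ
  have hδpos : ∀ m, 0 < δ m := fun m => by positivity
  have hδle : ∀ m, δ m ≤ ε := fun m => by
    rw [hδ]
    exact div_le_self hε.le (by have := Nat.cast_nonneg (α := ℝ) m; linarith)
  have hδlim : Tendsto δ atTop (𝓝 0) := by
    have h := tendsto_one_div_add_atTop_nhds_zero_nat (𝕜 := ℝ)
    have h' : Tendsto (fun m : ℕ => 1 / ((↑(m + 1) : ℝ) + 1)) atTop (𝓝 0) := h.comp (tendsto_add_atTop_nat 1)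
    have h'' := h'.const_mul ε
    rw [mul_zero] at h''
    refine h''.congr fun m => ?_
    simp only [hδ, Nat.cast_add, Nat.cast_one]
    ring
  set Am : ℕ → Set (ι → ℝ) := fun m => A ∩ {x | ∀ i, x i ≤ p' i - δ m} with hAm
  have mAm : ∀ m, MeasurableSet (Am m) := fun m => by
    refine mA.inter ?_
    rw [Set.setOf_forall]
    exact MeasurableSet.iInter fun i => measurableSet_le (measurable_pi_apply i) measurable_const
  have hcover : A ⊆ (⋃ m, Am m) ∪ ⋃ i, {x : ι → ℝ | x i = p' i} := by
    intro x hx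
    by_cases h : ∀ i, x i < p' i
    · -- some `δ m` is below the minimal gap
      left
      have hgap : ∀ i, ∀ᶠ m in atTop, x i ≤ p' i - δ m := fun i => by
        have : ∀ᶠ m in atTop, δ m < p' i - x i := (tendsto_order.1 hδlim).2 _ (by linarith [h i])
        filter_upwards [this] with m hm
        linarith
      obtain ⟨m, hm⟩ := (eventually_all.2 hgap).exists
      exact Set.mem_iUnion.2 ⟨m, hx, hm⟩
    · right
      push Not at h
      obtain ⟨i, hi⟩ := h
      have hxi : x i ≤ p i := (Set.mem_univ_pi.1 hx.2 i).2
      exact Set.mem_iUnion.2 ⟨i, le_antisymm (hxi.trans (hpp' i)) hi⟩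
  have hhyp : volume (⋃ i, {x : ι → ℝ | x i = p' i}) = 0 := by
    refine measure_iUnion_null fun i => ?_
    rw [volume_pi]
    exact Measure.pi_hyperplane (fun _ : ι => (volume : Measure ℝ)) i (p' i)
  obtain ⟨m, hm⟩ : ∃ m, volume (Am m) ≠ 0 := by
    by_contra hall
    push Not at hall
    exact hA0 (measure_mono_null hcover (measure_union_null (measure_iUnion_null hall) hhyp))
  -- the small corner at `p'`
  set B := Set.pi univ fun i => Ioc (p' i - δ m) (p' i) with hB
  have mB : MeasurableSet B := measurableSet_lowerCorner p' _
  have hB0 : volume B ≠ 0 := by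
    rw [hB, volume_lowerCorner]
    exact pow_ne_zero _ (ENNReal.ofReal_pos.2 (hδpos m)).ne'
  have hBC' : B ⊆ C' := fun x hx => by
    rw [Set.mem_univ_pi] at hx ⊢
    intro i
    exact ⟨by linarith [(hx i).1, hδle m], (hx i).2⟩
  -- the null set above the essential supremum at `p'`
  set N := {z | e' < g z} ∩ C' with hN
  have hN0 : volume N = 0 := measure_inter_eq_zero_of_essSup_restrict_le hg le_rfl
  have hprod0 : ((volume : Measure (ι → ℝ)).prod volume) (Am m ×ˢ B) ≠ 0 := by
    rw [Measure.prod_prod]; exact mul_ne_zero hm hB0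
  have good : ∀ᵐ z ∂(volume : Measure (ι → ℝ)).prod volume, (z.1 ≤ z.2 → g z.1 ≤ g z.2) ∧ z.2 ∉ N := by
    refine hmono.and ?_
    have : ∀ᵐ y ∂(volume : Measure (ι → ℝ)), y ∉ N := by
      rw [ae_iff]; simpa only [not_not, Set.setOf_mem_eq] using hN0
    exact (Measure.quasiMeasurePreserving_snd (μ := (volume : Measure (ι → ℝ)))
      (ν := (volume : Measure (ι → ℝ)))).ae this
  obtain ⟨z, ⟨hz1, hz2⟩, hzmono, hzN⟩ : ∃ z ∈ Am m ×ˢ B, (z.1 ≤ z.2 → g z.1 ≤ g z.2) ∧ z.2 ∉ N := by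
    by_contra hne
    push Not at hne
    apply hprod0
    refine measure_mono_null (fun z hz => ?_) (ae_iff.1 good)
    exact fun h => h.2 (hne z hz h.1)
  have hle : z.1 ≤ z.2 := fun i => by
    have h1 : z.1 i ≤ p' i - δ m := hz1.2 i
    have h2 : p' i - δ m < z.2 i := (Set.mem_univ_pi.1 hz2 i).1
    linarith
  have hgz2 : g z.2 ≤ e' := by
    by_contra h
    exact hzN ⟨not_le.1 h, hBC' hz2⟩
  have : a < g z.1 := hz1.1.1
  exact (lt_irrefl a) ((this.trans_le ((hzmono hle).trans hgz2)).trans ha1)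

/-! ### The local envelope theorem -/

/-- **The lower-corner essential envelope of a locally bounded density, with monotonicity.**  Let
`g : ℝ^ι → [c₀, ∞]` be measurable, MTP₂ on Lebesgue-almost every pair, non-decreasing on Lebesgue-almost every
comparable pair, and LOCALLY bounded in the sense that for every `q` there is `M_q < ∞` with `g ≤ M_q` almost
everywhere on `{z | z ≤ q}`.  Then `F(p) := inf_n ess sup_{∏ᵢ (pᵢ − 1/(n+1), pᵢ]} g` is Borel measurable,
`c₀ ≤ F < ∞`, `F = g` almost everywhere, `F(x) F(y) ≤ F(x ∧ y) F(x ∨ y)` for ALL `x, y`, and `F` is monotone at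
EVERY comparable pair. [this work] -/
theorem exists_measurable_monotone_mtp2_version_of_ae_local (g : (ι → ℝ) → ℝ≥0∞) (hg : Measurable g) {c₀ : ℝ≥0∞}
    (hcg : ∀ x, c₀ ≤ g x)
    (hloc : ∀ q : ι → ℝ, ∃ M : ℝ≥0∞, M ≠ ∞ ∧ ∀ᵐ z ∂(volume : Measure (ι → ℝ)), z ≤ q → g z ≤ M)
    (hMTP : ∀ᵐ p ∂(volume : Measure (ι → ℝ)).prod volume, g p.1 * g p.2 ≤ g (p.1 ⊓ p.2) * g (p.1 ⊔ p.2))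
    (hmono : ∀ᵐ p ∂(volume : Measure (ι → ℝ)).prod volume, p.1 ≤ p.2 → g p.1 ≤ g p.2) :
    ∃ F : (ι → ℝ) → ℝ≥0∞, Measurable F ∧ (∀ x, c₀ ≤ F x ∧ F x ≠ ∞) ∧ F =ᵐ[volume] g ∧
      (∀ x y, F x * F y ≤ F (x ⊓ y) * F (x ⊔ y)) ∧ Monotone F := by
  -- radii, corners, essential suprema
  set r : ℕ → ℝ := fun n => ((n : ℝ) + 1)⁻¹ with hr
  have hrpos : ∀ n, 0 < r n := fun n => by positivity
  have hr_anti : Antitone r := fun m n hmn => by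
    have hmn' : (m : ℝ) ≤ n := by exact_mod_cast hmn
    exact inv_anti₀ (by positivity) (by linarith)
  have hrn : Tendsto r atTop (𝓝[>] 0) := by
    refine tendsto_nhdsWithin_iff.2 ⟨?_, Eventually.of_forall fun n => hrpos n⟩
    simpa only [hr, one_div] using tendsto_one_div_add_atTop_nhds_zero_nat (𝕜 := ℝ)
  set E : ℕ → (ι → ℝ) → ℝ≥0∞ := fun n p =>
    essSup g (volume.restrict (Set.pi univ fun i => Ioc (p i - r n) (p i))) with hE
  -- local upper bounds `E n p ≤ M_p < ∞`, lower bound `c₀ ≤ E n p`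
  have hEM : ∀ p, ∃ M : ℝ≥0∞, M ≠ ∞ ∧ ∀ n, E n p ≤ M := by
    intro p
    obtain ⟨M, hM, hle⟩ := hloc p
    refine ⟨M, hM, fun n => essSup_le_of_ae_le M ?_⟩
    rw [Filter.EventuallyLE, ae_restrict_iff' (measurableSet_lowerCorner p _)]
    filter_upwards [hle] with z hz hzC
    exact hz (le_of_mem_lowerCorner hzC)
  have hEc : ∀ n p, c₀ ≤ E n p := by
    intro n p
    have hC0 : volume.restrict (Set.pi univ fun i => Ioc (p i - r n) (p i)) ≠ 0 := by
      intro h0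
      have h1 : volume (Set.pi univ fun i => Ioc (p i - r n) (p i)) = 0 := by
        rw [← Measure.restrict_apply_self, h0]; rfl
      rw [volume_lowerCorner] at h1
      exact pow_ne_zero _ (ENNReal.ofReal_pos.2 (hrpos n)).ne' h1
    calc c₀ = essSup (fun _ : ι → ℝ => c₀) (volume.restrict (Set.pi univ fun i => Ioc (p i - r n) (p i))) :=
          (essSup_const _ hC0).symm
      _ ≤ E n p := essSup_mono_ae (Eventually.of_forall fun x => hcg x)
  have hET : ∀ n p, E n p ≠ ∞ := fun n p => by
    obtain ⟨M, hM, hle⟩ := hEM p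
    exact ne_top_of_le_ne_top hM (hle n)
  -- antitone in `n`
  have hEanti : ∀ p, Antitone fun n => E n p := by
    intro p m n hmn
    simp only [hE]
    refine essSup_mono_measure' (Measure.restrict_mono (fun x hx => ?_) le_rfl)
    rw [Set.mem_univ_pi] at hx ⊢
    intro i
    exact ⟨lt_of_le_of_lt (sub_le_sub_left (hr_anti hmn) _) (hx i).1, (hx i).2⟩
  -- monotone in `p`
  have hEmono : ∀ n, Monotone (E n) := fun n p p' hpp' => essSup_lowerCorner_mono hg hmono (hrpos n) hpp'
  -- MTP₂ of `E n` at every pair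
  have hEmtp : ∀ n p q, E n p * E n q ≤ E n (p ⊓ q) * E n (p ⊔ q) := by
    intro n p q
    refine ENNReal.mul_le_of_forall_lt fun a ha b hb => ?_
    set A := {x | a < g x} ∩ Set.pi univ fun i => Ioc (p i - r n) (p i) with hA
    set B := {y | b < g y} ∩ Set.pi univ fun i => Ioc (q i - r n) (q i) with hB
    have mA : MeasurableSet A := (measurableSet_lt measurable_const hg).inter (measurableSet_lowerCorner p _)
    have mB : MeasurableSet B := (measurableSet_lt measurable_const hg).inter (measurableSet_lowerCorner q _)
    have hA0 : volume A ≠ 0 := by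
      rw [hA, ← Measure.restrict_apply (measurableSet_lt measurable_const hg)]
      exact measure_ne_zero_of_lt_essSup' ha
    have hB0 : volume B ≠ 0 := by
      rw [hB, ← Measure.restrict_apply (measurableSet_lt measurable_const hg)]
      exact measure_ne_zero_of_lt_essSup' hb
    have hAB : ((volume : Measure (ι → ℝ)).prod volume) (A ×ˢ B) ≠ 0 := by
      rw [Measure.prod_prod]; exact mul_ne_zero hA0 hB0
    set N₃ := {z | E n (p ⊓ q) < g z} ∩ Set.pi univ fun i => Ioc ((p ⊓ q) i - r n) ((p ⊓ q) i) with hN₃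
    set N₄ := {z | E n (p ⊔ q) < g z} ∩ Set.pi univ fun i => Ioc ((p ⊔ q) i - r n) ((p ⊔ q) i) with hN₄
    have hN₃0 : volume N₃ = 0 := measure_inter_eq_zero_of_essSup_restrict_le hg le_rfl
    have hN₄0 : volume N₄ = 0 := measure_inter_eq_zero_of_essSup_restrict_le hg le_rfl
    have good : ∀ᵐ z ∂(volume : Measure (ι → ℝ)).prod volume,
        g z.1 * g z.2 ≤ g (z.1 ⊓ z.2) * g (z.1 ⊔ z.2) ∧ z.1 ⊓ z.2 ∉ N₃ ∧ z.1 ⊔ z.2 ∉ N₄ := by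
      have h3 : ∀ᵐ z ∂(volume : Measure (ι → ℝ)).prod volume, z.1 ⊓ z.2 ∉ N₃ := by
        rw [ae_iff]; simpa only [not_not] using volume_prod_inf_mem_null hN₃0
      have h4 : ∀ᵐ z ∂(volume : Measure (ι → ℝ)).prod volume, z.1 ⊔ z.2 ∉ N₄ := by
        rw [ae_iff]; simpa only [not_not] using volume_prod_sup_mem_null hN₄0
      filter_upwards [hMTP, h3, h4] with z h1 h2 h3 using ⟨h1, h2, h3⟩
    obtain ⟨z, ⟨hzA, hzB⟩, hz1, hz3, hz4⟩ : ∃ z ∈ A ×ˢ B,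
        g z.1 * g z.2 ≤ g (z.1 ⊓ z.2) * g (z.1 ⊔ z.2) ∧ z.1 ⊓ z.2 ∉ N₃ ∧ z.1 ⊔ z.2 ∉ N₄ := by
      by_contra hne
      push Not at hne
      apply hAB
      refine measure_mono_null (fun z hz => ?_) (ae_iff.1 good)
      exact fun h => h.2.2 (hne z hz h.1 h.2.1)
    have hx3 : z.1 ⊓ z.2 ∈ Set.pi univ fun i => Ioc ((p ⊓ q) i - r n) ((p ⊓ q) i) := inf_mem_lowerCorner hzA.2 hzB.2
    have hx4 : z.1 ⊔ z.2 ∈ Set.pi univ fun i => Ioc ((p ⊔ q) i - r n) ((p ⊔ q) i) := sup_mem_lowerCorner hzA.2 hzB.2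
    have hg3 : g (z.1 ⊓ z.2) ≤ E n (p ⊓ q) := by
      by_contra hlt
      exact hz3 ⟨not_le.1 hlt, hx3⟩
    have hg4 : g (z.1 ⊔ z.2) ≤ E n (p ⊔ q) := by
      by_contra hlt
      exact hz4 ⟨not_le.1 hlt, hx4⟩
    calc a * b ≤ g z.1 * g z.2 := mul_le_mul' hzA.1.le hzB.1.le
      _ ≤ g (z.1 ⊓ z.2) * g (z.1 ⊔ z.2) := hz1
      _ ≤ E n (p ⊓ q) * E n (p ⊔ q) := mul_le_mul' hg3 hg4
  -- the envelope
  set F : (ι → ℝ) → ℝ≥0∞ := fun p => ⨅ n, E n p with hF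
  have hFc : ∀ p, c₀ ≤ F p := fun p => le_iInf fun n => hEc n p
  have hFT : ∀ p, F p ≠ ∞ := fun p => ne_top_of_le_ne_top (hET 0 p) (iInf_le _ 0)
  have hFt : ∀ p, Tendsto (fun n => E n p) atTop (𝓝 (F p)) := fun p => tendsto_atTop_iInf (hEanti p)
  have hFm : Measurable F := Measurable.iInf fun n => measurable_essSup_lowerCorner hg (r n)
  refine ⟨F, hFm, fun p => ⟨hFc p, hFT p⟩, ?_, fun x y => ?_, fun x y hxy => iInf_mono fun n => hEmono n hxy⟩
  · -- `F = g` a.e.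
    have hsw : ∀ᵐ z ∂(volume : Measure (ι → ℝ)).prod volume, z.2 ≤ z.1 → g z.2 ≤ g z.1 := by
      have := (Measure.measurePreserving_swap (μ := (volume : Measure (ι → ℝ)))
        (ν := (volume : Measure (ι → ℝ)))).quasiMeasurePreserving.ae hmono
      filter_upwards [this] with z hz using hz
    have hc1 : ∀ᵐ p ∂(volume : Measure (ι → ℝ)), ∀ᵐ x ∂(volume : Measure (ι → ℝ)), x ≤ p → g x ≤ g p :=
      Measure.ae_ae_of_ae_prod hsw
    have hc2 : ∀ᵐ p ∂(volume : Measure (ι → ℝ)), ∀ t : ℚ, p ∈ {x | ENNReal.ofReal t < g x} →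
        Tendsto (fun ρ => volume ({x | ENNReal.ofReal t < g x}ᶜ ∩ closedBall p ρ) / volume (closedBall p ρ))
          (𝓝[>] 0) (𝓝 0) := by
      rw [ae_all_iff]
      intro t
      have mS : MeasurableSet {x : ι → ℝ | ENNReal.ofReal (t : ℝ) < g x} := measurableSet_lt measurable_const hg
      filter_upwards [Besicovitch.ae_tendsto_measure_inter_div_of_measurableSet (volume : Measure (ι → ℝ)) mS.compl]
        with p hp hpt
      have hn : p ∉ ({x : ι → ℝ | ENNReal.ofReal (t : ℝ) < g x})ᶜ := Set.notMem_compl_iff.2 hpt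
      have h0 : ({x : ι → ℝ | ENNReal.ofReal (t : ℝ) < g x}ᶜ).indicator (1 : (ι → ℝ) → ℝ≥0∞) p = 0 :=
        Set.indicator_of_notMem hn _
      rwa [h0] at hp
    filter_upwards [hc1, hc2] with p hp1 hp2
    apply le_antisymm
    · refine (iInf_le _ 0).trans (essSup_le_of_ae_le _ ?_)
      rw [Filter.EventuallyLE, ae_restrict_iff' (measurableSet_lowerCorner p _)]
      filter_upwards [hp1] with x hx hxC
      exact hx (le_of_mem_lowerCorner hxC)
    · refine le_iInf fun n => le_of_forall_lt_imp_le_of_dense fun a ha => ?_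
      obtain ⟨t, -, hat, htg⟩ := ENNReal.lt_iff_exists_rat_btwn.1 ha
      change a < ENNReal.ofReal t at hat
      change ENNReal.ofReal t < g p at htg
      refine hat.le.trans ?_
      set S := {x : ι → ℝ | ENNReal.ofReal (t : ℝ) < g x} with hS
      have mS : MeasurableSet S := measurableSet_lt measurable_const hg
      have hd : Tendsto (fun m => volume (Sᶜ ∩ closedBall p (r m)) / volume (closedBall p (r m))) atTop (𝓝 0) :=
        (hp2 t htg).comp hrn
      have hsmall : ∀ᶠ m in atTop, volume (Sᶜ ∩ closedBall p (r m)) / volume (closedBall p (r m)) <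
          ((2 : ℝ≥0∞) ^ Fintype.card ι)⁻¹ :=
        (tendsto_order.1 hd).2 _ (ENNReal.inv_pos.2 (ENNReal.pow_ne_top ENNReal.ofNat_ne_top))
      obtain ⟨m₀, hm₀⟩ := hsmall.exists_forall_of_atTop
      set m := max n m₀ with hm
      refine le_trans ?_ (hEanti p (le_max_left n m₀))
      by_contra hlt
      have hz : volume ({x | ENNReal.ofReal (t : ℝ) < g x} ∩ Set.pi univ fun i => Ioc (p i - r m) (p i)) = 0 :=
        measure_inter_eq_zero_of_essSup_restrict_le hg (not_le.1 hlt).le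
      have hC : volume (Set.pi univ fun i => Ioc (p i - r m) (p i)) = ENNReal.ofReal (r m) ^ Fintype.card ι :=
        volume_lowerCorner p (r m)
      have hBall : volume (closedBall p (r m)) =
          2 ^ Fintype.card ι * ENNReal.ofReal (r m) ^ Fintype.card ι := volume_closedBall_eq_pow_mul p (hrpos m).le
      have hR0 : ENNReal.ofReal (r m) ^ Fintype.card ι ≠ 0 :=
        pow_ne_zero _ (ENNReal.ofReal_pos.2 (hrpos m)).ne'
      have hRT : ENNReal.ofReal (r m) ^ Fintype.card ι ≠ ∞ := ENNReal.pow_ne_top ENNReal.ofReal_ne_top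
      have h2T : (2 : ℝ≥0∞) ^ Fintype.card ι ≠ ∞ := ENNReal.pow_ne_top ENNReal.ofNat_ne_top
      have h20 : (2 : ℝ≥0∞) ^ Fintype.card ι ≠ 0 := pow_ne_zero _ two_ne_zero
      have hB0 : volume (closedBall p (r m)) ≠ 0 := by rw [hBall]; exact mul_ne_zero h20 hR0
      have hBT : volume (closedBall p (r m)) ≠ ∞ := by rw [hBall]; exact ENNReal.mul_ne_top h2T hRT
      have hlt' : volume (Sᶜ ∩ closedBall p (r m)) < volume (Set.pi univ fun i => Ioc (p i - r m) (p i)) := by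
        have h1 := (ENNReal.div_lt_iff (Or.inl hB0) (Or.inl hBT)).1 (hm₀ m (le_max_right n m₀))
        rw [hBall, ← mul_assoc, ENNReal.inv_mul_cancel h20 h2T, one_mul, ← hC] at h1
        exact h1
      have hsub : (Set.pi univ fun i => Ioc (p i - r m) (p i)) ⊆
          ({x | ENNReal.ofReal (t : ℝ) < g x} ∩ Set.pi univ fun i => Ioc (p i - r m) (p i)) ∪
            (Sᶜ ∩ closedBall p (r m)) := by
        intro x hx
        by_cases hxS : x ∈ S
        · exact Or.inl ⟨hxS, hx⟩
        · exact Or.inr ⟨hxS, lowerCorner_subset_closedBall p (hrpos m).le hx⟩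
      have hle : volume (Set.pi univ fun i => Ioc (p i - r m) (p i)) ≤
          volume ({x | ENNReal.ofReal (t : ℝ) < g x} ∩ Set.pi univ fun i => Ioc (p i - r m) (p i)) +
            volume (Sᶜ ∩ closedBall p (r m)) :=
        (measure_mono hsub).trans (measure_union_le _ _)
      rw [hz, zero_add] at hle
      exact (lt_irrefl _) (hlt'.trans_le hle)
  · -- MTP₂ at every pair: pass to the limit
    have hL : Tendsto (fun n => E n x * E n y) atTop (𝓝 (F x * F y)) :=
      ENNReal.Tendsto.mul (hFt x) (Or.inr (hFT y)) (hFt y) (Or.inr (hFT x))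
    have hR : Tendsto (fun n => E n (x ⊓ y) * E n (x ⊔ y)) atTop (𝓝 (F (x ⊓ y) * F (x ⊔ y))) :=
      ENNReal.Tendsto.mul (hFt _) (Or.inr (hFT _)) (hFt _) (Or.inr (hFT _))
    exact le_of_tendsto_of_tendsto' hL hR fun n => hEmtp n x y

end Summit.CriticalPhenomena.PercolationContinuityZ3.Theorems.SahiAEFourFunctions
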